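import Summits.CriticalPhenomena.PercolationContinuityZ3.Theorems.SahiCMTP2BoxCriterion

/-!
# Density-free cMTP₂ (5.1) with a real-valued conditioned variable = likelihood-ratio monotonicity of the slices

Support file of the Sahi cell (`prim-sahi`, typer seat, generation 18; `--supports stmt-CriticalPhenomena-4575`).
Theorems only (no definitions, no named facts, no sorries).

When the conditioned block is a CHAIN (`|B| = 1` in [FuchsWang2026], `Y = ℝ` or any linear order), `x ∧ y`, `x ∨ y` are
just `min, max`, and Fuchs–Wang's (5.1) for a finite law `μ` on `ℝ^A × Y` says exactly that the slices
`ν_t := law of X_A on {X_B ≤ t}` (`C ↦ μ(C × (−∞,t])`) INCREASE WITH `t` IN THE DENSITY-FREE MULTIVARIATE LIKELIHOOD-RATIO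
(tp₂) ORDER of Müller–Stoyan §3.11 / Whitt's uniform conditional stochastic order (tree
`Literature.Probability.LatticeModels.Affiliation.mTP2Le`, `mBoxTP2Le`):

* `isCMTP2Box_iff_slices_mBoxTP2Le` — box forms, any measurable lattice `X` as conditioning block;
* **`isCMTP2Set_iff_slices_mTP2Le`** — set forms on `ℝ^A × Y` (both sides upgraded by their box criteria:
  `isCMTP2Set_iff_isCMTP2Box` and `mTP2Le_iff_mBoxTP2Le`).

So for `d = 2` the paper's `cMTP₂^set(X₂|X₁)` is "`[X₁ | X₂ ≤ s] ≤_lr [X₁ | X₂ ≤ t]` for `s ≤ t`" — tp₂ in `(x₁, x₂)` of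
`P(X₂ ≤ x₂, X₁ ∈ dx₁)`, cf. [FuchsWang2026] Rem. 2.1 (3) for the density version.  No sorries, no new axioms.
-/

noncomputable section

namespace Summit.CriticalPhenomena.PercolationContinuityZ3.Theorems.SahiCMTP2

open MeasureTheory Set Function
open Literature.Probability.LatticeModels Literature.Probability.LatticeModels.Affiliation
open scoped ENNReal SetFamily

section Chain

variable {X Y : Type*} [MeasurableSpace X] [Lattice X] [TopologicalSpace X] [OrderClosedTopology X]
  [OpensMeasurableSpace X] [MeasurableSpace Y] [LinearOrder Y]

/-- **Box form of (5.1) with a chain as conditioned block ⟺ the slices increase in the box tp₂ order.** [this work] -/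
theorem isCMTP2Box_iff_slices_mBoxTP2Le (μ : Measure (X × Y)) :
    IsCMTP2Box μ ↔ ∀ s t : Y, s ≤ t →
      mBoxTP2Le ((μ.restrict (univ ×ˢ Iic s)).map Prod.fst) ((μ.restrict (univ ×ˢ Iic t)).map Prod.fst) := by
  constructor
  · intro h s t hst a b a' b'
    rw [map_fst_restrict_prod_Iic_apply μ s measurableSet_Icc, map_fst_restrict_prod_Iic_apply μ t measurableSet_Icc,
      map_fst_restrict_prod_Iic_apply μ s measurableSet_Icc, map_fst_restrict_prod_Iic_apply μ t measurableSet_Icc]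
    have h1 := h a b a' b' s t
    rwa [min_eq_left hst, max_eq_right hst] at h1
  · intro h a b a' b' x y
    rcases le_total x y with hxy | hyx
    · have h1 := h x y hxy a b a' b'
      rw [map_fst_restrict_prod_Iic_apply μ x measurableSet_Icc, map_fst_restrict_prod_Iic_apply μ y measurableSet_Icc,
        map_fst_restrict_prod_Iic_apply μ x measurableSet_Icc, map_fst_restrict_prod_Iic_apply μ y measurableSet_Icc]
        at h1
      rwa [min_eq_left hxy, max_eq_right hxy]
    · have h1 := h y x hyx a' b' a b
      rw [map_fst_restrict_prod_Iic_apply μ y measurableSet_Icc, map_fst_restrict_prod_Iic_apply μ x measurableSet_Icc,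
        map_fst_restrict_prod_Iic_apply μ y measurableSet_Icc, map_fst_restrict_prod_Iic_apply μ x measurableSet_Icc]
        at h1
      rw [min_eq_right hyx, max_eq_left hyx, mul_comm, inf_comm a, inf_comm b, sup_comm a, sup_comm b]
      exact h1

end Chain

section Real

variable {ι Y : Type*} [Fintype ι] [MeasurableSpace Y] [LinearOrder Y]

/-- **(5.1) with a chain as conditioned block ⟺ the slices `[X_A | X_B ≤ t]` increase with `t` in the density-free
multivariate likelihood-ratio order** (`mTP2Le`, Müller–Stoyan (3.11.2) in set form), for every finite law on `ℝ^A × Y`.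
[this work] -/
theorem isCMTP2Set_iff_slices_mTP2Le (μ : Measure ((ι → ℝ) × Y)) [IsFiniteMeasure μ] :
    IsCMTP2Set μ ↔ ∀ s t : Y, s ≤ t →
      mTP2Le ((μ.restrict (univ ×ˢ Iic s)).map Prod.fst) ((μ.restrict (univ ×ˢ Iic t)).map Prod.fst) := by
  rw [isCMTP2Set_iff_isCMTP2Box, isCMTP2Box_iff_slices_mBoxTP2Le]
  refine forall_congr' fun s => forall_congr' fun t => forall_congr' fun _ => ?_
  rw [mTP2Le_iff_mBoxTP2Le]

end Real

end Summit.CriticalPhenomena.PercolationContinuityZ3.Theorems.SahiCMTP2
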